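import Summits.CriticalPhenomena.PercolationContinuityZ3.Theorems.PercNearOneGluingNoHeavyLowerTailAttachedChampionLevelOne
import HarnessLib

/-!
# `NoHeavyLowerTail` (stmt-CriticalPhenomena-4575) — Kozma–Nitzan's Lemma 3(i) for a SET of relays ('UX'), at LEVEL ONE

Support file (prover `prim-hp-5`, hull-port cell, gen 11; `--supports stmt-CriticalPhenomena-4575`).  No definitions,
no named facts, no sorries.  `μ = prodBernoulli w` on `Fin n`, relays `A`, observer `o`, `π(v) = {a ∈ A : v ↔ a}`,
`D_v = {v ↮ A ∖ v}` (`= {|π(v)| ≤ 1}` for `v ∈ A`).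

The family UX (memo OBSERVER-SET.md §24): for a relay `q` and a set `X` of relays each of which `q` beats
(`μ(|π(x)| ≤ j) ≤ μ(|π(q)| ≤ j)`, `x ∈ X`),
    `μ(o ↔ X, |π(o)| ≤ j) ≤ μ(o ↔ X, |π(q)| ≤ j)`.
For `X = {r}` this is Kozma–Nitzan's Lemma 3(i) (`|π(o)| = |π(r)|` on `{o ↔ r}`); for `X = A ∖ q` and a champion `q`
it is the registered stub `stub_attachedChampion` (XZ / LSP).  Census: 0 violations (seat gen 11, all levels).
This file PROVES the level `j = 1` for EVERY `X`:

* `UXLevelOne.ux_level_one_sum` — `Σ_{b ∈ X} μ(o ↔ b, D_b) ≤ μ(D_q ∩ {o ↔ X})` whenever `q ∈ A`, `X ⊆ A ∖ q` and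
  `μ(D_b) ≤ μ(D_q)` for every `b ∈ X`;
* `ux_level_one` — the same in the stub's vocabulary: `μ(o ↔ X, |π(o)| ≤ 1) ≤ μ(o ↔ X, |π(q)| ≤ 1)`.

Proof = the lead's level-one chain (`AttachedChampionLevelOne.level_one_of_pairSep_pos`, Kozma–Nitzan's Lemma 2 with
singleton blocks + one set-BHK step) with the attachment event `{o ↔ A ∖ q}` replaced by `{o ↔ X}`: terminal
separation (BHK 2006 Thm 1.3) for each `b ∈ X`, disjointness of `{o ↔ b} ∩ Sep` over `b`, and negative correlation,
given `D_q = {A∖q ↮ q}`, of the increasing event `{o ↔ X}` and the decreasing event `{A∖q pairwise separated}` of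
the cluster `C_{A∖q}` (`sep_touchSet_negCorr`).  The null case `μ(Sep) = 0` is removed by scaling the weights.
-/

noncomputable section

namespace Summit.CriticalPhenomena.PercolationContinuityZ3.Theorems

open MeasureTheory Set Filter Literature.Probability.LatticeModels Literature.Probability.Percolation
open scoped Classical BigOperators Topology

namespace UXLevelOne

open AttachedChampionLevelOne

variable {n : ℕ}

/-- "Some point of `X` is joined to `o` inside the edge set `C`" is increasing in `C`. [folklore] -/
theorem touchSet_mono (X : Set (Fin n)) (o : Fin n) :
    ∀ ⦃C C' : Set (Sym2 (Fin n))⦄, C ⊆ C' →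
      (∃ x ∈ X, (SimpleGraph.fromEdgeSet C).Reachable x o) →
      (∃ x ∈ X, (SimpleGraph.fromEdgeSet C').Reachable x o) := by
  rintro C C' hCC' ⟨x, hx, hr⟩
  exact ⟨x, hx, hr.mono (SimpleGraph.fromEdgeSet_mono hCC')⟩

/-- **The set-BHK step for a sub-family of attachments.**  For `q ∉ S`, `X ⊆ S`, `D = {S ↮ q}`,
`U_X = ⋃_{b ∈ X} {o ↔ b}` and `Q = {S pairwise separated}`:
`μ(D) · μ(D ∩ U_X ∩ Q) ≤ μ(D ∩ U_X) · μ(D ∩ Q)` — given `D`, the increasing event `U_X` and the decreasing event `Q`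
of the cluster `C_S` are negatively correlated (BHK 2006 Thm 1.3 for the set `S`).
[cite: VandenbergHaggstromKahn2005, Thm. 1.3 with Remark 1 (p. 5)] -/
theorem sep_touchSet_negCorr (w : Sym2 (Fin n) → unitInterval) (S X : Finset (Fin n)) (q o : Fin n)
    (hX : X ⊆ S) :
    (prodBernoulli w).real {ω : BondConfig (Fin n) | ∀ t ∈ S, ω ∉ openConn q t} *
      (prodBernoulli w).real ({ω : BondConfig (Fin n) | ∀ t ∈ S, ω ∉ openConn q t} ∩
        ((⋃ b ∈ X, openConn o b) ∩ {ω | ∀ t ∈ S, ∀ t' ∈ S, t ≠ t' → ω ∉ openConn t t'})) ≤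
    (prodBernoulli w).real ({ω : BondConfig (Fin n) | ∀ t ∈ S, ω ∉ openConn q t} ∩
        ⋃ b ∈ X, openConn o b) *
      (prodBernoulli w).real ({ω : BondConfig (Fin n) | ∀ t ∈ S, ω ∉ openConn q t} ∩
        {ω | ∀ t ∈ S, ∀ t' ∈ S, t ≠ t' → ω ∉ openConn t t'}) := by
  set μ := prodBernoulli w with hμ
  set D : Set (BondConfig (Fin n)) := {ω | ∀ t ∈ S, ω ∉ openConn q t} with hD
  have hDeq : {ω : BondConfig (Fin n) | ∀ s ∈ (↑S : Set (Fin n)), ∀ t ∈ ({q} : Set (Fin n)),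
      ¬ (openGraph ω).Reachable s t} = D := by
    ext ω
    simp only [Set.mem_setOf_eq, Finset.mem_coe, Set.mem_singleton_iff, forall_eq, hD]
    refine forall₂_congr fun t ht => ?_
    change ¬ (openGraph ω).Reachable t q ↔ ¬ (openGraph ω).Reachable q t
    rw [SimpleGraph.reachable_comm]
  set U : Set (BondConfig (Fin n)) := ⋃ b ∈ X, openConn o b with hU
  set Q : Set (BondConfig (Fin n)) := {ω | ∀ t ∈ S, ∀ t' ∈ S, t ≠ t' → ω ∉ openConn t t'} with hQ
  have hUeq : {ω : BondConfig (Fin n) | ∃ x ∈ (↑X : Set (Fin n)),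
      (SimpleGraph.fromEdgeSet (⋃ s ∈ (↑S : Set (Fin n)), openEdgeCluster ω s)).Reachable x o} = U := by
    ext ω
    simp only [Set.mem_setOf_eq, hU, Set.mem_iUnion, Finset.mem_coe, exists_prop]
    refine exists_congr fun b => ?_
    constructor
    · rintro ⟨hb, hr⟩
      refine ⟨hb, ?_⟩
      have h := (reachable_iff_reachable_fromEdgeSet_biUnion ω (↑S : Set (Fin n))
        (Finset.mem_coe.2 (hX hb)) o).2 hr
      exact (h.symm : (openGraph ω).Reachable o b)
    · rintro ⟨hb, hob⟩
      refine ⟨hb, ?_⟩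
      have hbo : (openGraph ω).Reachable b o := (show (openGraph ω).Reachable o b from hob).symm
      exact (reachable_iff_reachable_fromEdgeSet_biUnion ω (↑S : Set (Fin n))
        (Finset.mem_coe.2 (hX hb)) o).1 hbo
  have hQeq : {ω : BondConfig (Fin n) | ∃ s ∈ (↑S : Set (Fin n)), ∃ s' ∈ (↑S : Set (Fin n)), s ≠ s' ∧
      (SimpleGraph.fromEdgeSet (⋃ x ∈ (↑S : Set (Fin n)), openEdgeCluster ω x)).Reachable s s'} = Qᶜ := by
    ext ω
    simp only [Set.mem_setOf_eq, Set.mem_compl_iff, hQ, Finset.mem_coe, not_forall, not_not, exists_prop]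
    constructor
    · rintro ⟨s, hs, s', hs', hne, hr⟩
      exact ⟨s, hs, s', hs', hne, (reachable_iff_reachable_fromEdgeSet_biUnion ω _ hs s').2 hr⟩
    · rintro ⟨s, hs, s', hs', hne, hr⟩
      exact ⟨s, hs, s', hs', hne, (reachable_iff_reachable_fromEdgeSet_biUnion ω _ hs s').1 hr⟩
  have key := setCluster_upper_upper w (↑S : Set (Fin n)) ({q} : Set (Fin n))
    (fun C => ∃ x ∈ (↑X : Set (Fin n)), (SimpleGraph.fromEdgeSet C).Reachable x o)
    (fun C => ∃ s ∈ (↑S : Set (Fin n)), ∃ s' ∈ (↑S : Set (Fin n)), s ≠ s' ∧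
      (SimpleGraph.fromEdgeSet C).Reachable s s')
    (touchSet_mono _ o) (pairConn_mono _)
  rw [hDeq] at key
  change μ.real (D ∩ {ω | ∃ x ∈ (↑X : Set (Fin n)),
      (SimpleGraph.fromEdgeSet (⋃ s ∈ (↑S : Set (Fin n)), openEdgeCluster ω s)).Reachable x o}) *
      μ.real (D ∩ {ω | ∃ s ∈ (↑S : Set (Fin n)), ∃ s' ∈ (↑S : Set (Fin n)), s ≠ s' ∧
        (SimpleGraph.fromEdgeSet (⋃ x ∈ (↑S : Set (Fin n)), openEdgeCluster ω x)).Reachable s s'}) ≤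
    μ.real D * μ.real (D ∩ ({ω | ∃ x ∈ (↑X : Set (Fin n)),
        (SimpleGraph.fromEdgeSet (⋃ s ∈ (↑S : Set (Fin n)), openEdgeCluster ω s)).Reachable x o} ∩
      {ω | ∃ s ∈ (↑S : Set (Fin n)), ∃ s' ∈ (↑S : Set (Fin n)), s ≠ s' ∧
        (SimpleGraph.fromEdgeSet (⋃ x ∈ (↑S : Set (Fin n)), openEdgeCluster ω x)).Reachable s s'})) at key
  rw [hUeq, hQeq] at key
  have hmeas : ∀ s : Set (BondConfig (Fin n)), MeasurableSet s := fun _ => MeasurableSet.of_discrete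
  have h1 : μ.real (D ∩ Qᶜ) = μ.real D - μ.real (D ∩ Q) := by
    have := measureReal_inter_add_sdiff (μ := μ) (s := D) (hmeas Q)
    rw [Set.sdiff_eq] at this
    linarith
  have h2 : μ.real (D ∩ (U ∩ Qᶜ)) = μ.real (D ∩ U) - μ.real (D ∩ (U ∩ Q)) := by
    have := measureReal_inter_add_sdiff (μ := μ) (s := D ∩ U) (hmeas Q)
    rw [Set.sdiff_eq, Set.inter_assoc, Set.inter_assoc] at this
    linarith
  rw [h1, h2] at key
  nlinarith [key, measureReal_nonneg (μ := μ) (s := D), measureReal_nonneg (μ := μ) (s := D ∩ U)]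

/-- **The level-one UX chain with a non-null separation event (deficiency form).**  Terminal separation
`hTS` (= BHK 2006 Thm 1.3), `q ∈ A`, `X ⊆ A ∖ q`, `μ(D_b) ≤ μ(D_q) + δ` for all `b ∈ X`, and `μ(Sep) > 0`
(`Sep = {A pairwise separated}`) give `Σ_{b ∈ X} μ(o ↔ b, D_b) ≤ μ(D_q ∩ {o ↔ X}) + δ`.
[cite: KozmaNitzan2024, Lemma 2 (p. 6) — singleton blocks] -/
theorem ux_level_one_of_pairSep_pos
    (hTS : ∀ (n : ℕ) (w : Sym2 (Fin n) → unitInterval) (T : Finset (Fin n)) (o a : Fin n),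
      (prodBernoulli w).real (openConn o a ∩ {ω | ∀ t ∈ T, ω ∉ openConn a t}) *
        (prodBernoulli w).real ({ω | ∀ t ∈ T, ω ∉ openConn a t} ∩
            {ω | ∀ t ∈ T, ∀ t' ∈ T, t ≠ t' → ω ∉ openConn t t'}) ≤
      (prodBernoulli w).real {ω | ∀ t ∈ T, ω ∉ openConn a t} *
        (prodBernoulli w).real (openConn o a ∩ ({ω | ∀ t ∈ T, ω ∉ openConn a t} ∩
              {ω | ∀ t ∈ T, ∀ t' ∈ T, t ≠ t' → ω ∉ openConn t t'})))
    (w : Sym2 (Fin n) → unitInterval) (A X : Finset (Fin n)) (o q : Fin n) (δ : ℝ)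
    (hδ : 0 ≤ δ) (hq : q ∈ A) (hX : X ⊆ A.erase q)
    (hcmp : ∀ b ∈ X, (prodBernoulli w).real {ω | ∀ t ∈ A.erase b, ω ∉ openConn b t} ≤
      (prodBernoulli w).real {ω | ∀ t ∈ A.erase q, ω ∉ openConn q t} + δ)
    (hM : 0 < (prodBernoulli w).real
      {ω : Set (Sym2 (Fin n)) | ∀ x ∈ A, ∀ y ∈ A, x ≠ y → ω ∉ openConn x y}) :
    ∑ b ∈ X, (prodBernoulli w).real (openConn o b ∩ {ω | ∀ t ∈ A.erase b, ω ∉ openConn b t}) ≤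
      (prodBernoulli w).real ({ω | ∀ t ∈ A.erase q, ω ∉ openConn q t} ∩ ⋃ b ∈ X, openConn o b) + δ := by
  set μ := prodBernoulli w with hμ
  set Sep : Set (Set (Sym2 (Fin n))) := {ω | ∀ x ∈ A, ∀ y ∈ A, x ≠ y → ω ∉ openConn x y} with hSep
  set Dq : Set (Set (Sym2 (Fin n))) := {ω | ∀ t ∈ A.erase q, ω ∉ openConn q t} with hDq
  set U : Set (Set (Sym2 (Fin n))) := ⋃ b ∈ X, openConn o b with hU
  have hmeas : ∀ s : Set (Set (Sym2 (Fin n))), MeasurableSet s := fun _ => MeasurableSet.of_discrete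
  have hXA : X ⊆ A := hX.trans (Finset.erase_subset q A)
  -- (2) terminal separation + the deficient comparison, term by term for `b ∈ X`
  have h2 : ∀ b ∈ X,
      μ.real (openConn o b ∩ {ω | ∀ t ∈ A.erase b, ω ∉ openConn b t}) * μ.real Sep ≤
        (μ.real Dq + δ) * μ.real (openConn o b ∩ Sep) := by
    intro b hb
    have hbA : b ∈ A := hXA hb
    have key := hTS n w (A.erase b) o b
    rw [singleFinger_sep_inter_pairSep_eq A hbA] at key
    exact key.trans (mul_le_mul_of_nonneg_right (hcmp b hb) measureReal_nonneg)
  -- (3) disjointness of `{o ↔ b} ∩ Sep` over `b ∈ X`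
  have h3 : ∑ b ∈ X, μ.real (openConn o b ∩ Sep) = μ.real (U ∩ Sep) := by
    rw [hU, Set.iUnion₂_inter]
    exact (measureReal_biUnion_finset
      (singleFinger_pairwiseDisjoint_conn_inter_pairSep A X o hXA) (fun b _ => hmeas _)).symm
  have h23 : (∑ b ∈ X, μ.real (openConn o b ∩ {ω | ∀ t ∈ A.erase b, ω ∉ openConn b t})) *
      μ.real Sep ≤ μ.real Dq * μ.real (U ∩ Sep) + δ * μ.real Sep := by
    rw [Finset.sum_mul]
    calc ∑ b ∈ X, μ.real (openConn o b ∩ {ω | ∀ t ∈ A.erase b, ω ∉ openConn b t}) * μ.real Sep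
        ≤ ∑ b ∈ X, (μ.real Dq + δ) * μ.real (openConn o b ∩ Sep) := Finset.sum_le_sum h2
      _ = (μ.real Dq + δ) * μ.real (U ∩ Sep) := by rw [← Finset.mul_sum, h3]
      _ = μ.real Dq * μ.real (U ∩ Sep) + δ * μ.real (U ∩ Sep) := by ring
      _ ≤ μ.real Dq * μ.real (U ∩ Sep) + δ * μ.real Sep := by
          have : μ.real (U ∩ Sep) ≤ μ.real Sep := measureReal_mono Set.inter_subset_right (measure_ne_top μ _)
          nlinarith
  -- (4) the set-BHK step: `μ(D_q) μ(U ∩ Sep) ≤ μ(D_q ∩ U) μ(Sep)`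
  have h4 : μ.real Dq * μ.real (U ∩ Sep) ≤ μ.real (Dq ∩ U) * μ.real Sep := by
    have key := sep_touchSet_negCorr w (A.erase q) X q o hX
    have hSepEq : Dq ∩ {ω : Set (Sym2 (Fin n)) | ∀ t ∈ A.erase q, ∀ t' ∈ A.erase q, t ≠ t' → ω ∉ openConn t t'}
        = Sep := by
      rw [hDq, hSep]; exact singleFinger_sep_inter_pairSep_eq A hq
    have hUS : Dq ∩ (U ∩ {ω : Set (Sym2 (Fin n)) | ∀ t ∈ A.erase q, ∀ t' ∈ A.erase q, t ≠ t' →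
        ω ∉ openConn t t'}) = U ∩ Sep := by
      rw [← hSepEq, ← Set.inter_assoc, Set.inter_comm Dq U, Set.inter_assoc]
    rw [hUS, hSepEq] at key
    exact key
  -- (5) divide by `μ(Sep) > 0`
  have : (∑ b ∈ X, μ.real (openConn o b ∩ {ω | ∀ t ∈ A.erase b, ω ∉ openConn b t})) *
      μ.real Sep ≤ (μ.real (Dq ∩ U) + δ) * μ.real Sep := by nlinarith [h23, h4]
  exact le_of_mul_le_mul_right this hM

/-- **UX at level one, sum form** (unconditional): for `q ∈ A`, `X ⊆ A ∖ q` and `μ(D_b) ≤ μ(D_q)` for every `b ∈ X`,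
`Σ_{b ∈ X} μ(o ↔ b, D_b) ≤ μ(D_q ∩ {o ↔ X})` — the probability that `o` is joined to exactly one relay and that
relay lies in `X` is at most the probability that `o ↔ X` while `q` is isolated from the other relays.  Terminal
separation and weight continuity are hypotheses here (discharged in `ux_level_one`).
[cite: KozmaNitzan2024, Lemma 2 (p. 6), Lemma 3(i) (pp. 6–7)] -/
theorem ux_level_one_sum_of_terminalSeparation
    (hTS : ∀ (n : ℕ) (w : Sym2 (Fin n) → unitInterval) (T : Finset (Fin n)) (o a : Fin n),
      (prodBernoulli w).real (openConn o a ∩ {ω | ∀ t ∈ T, ω ∉ openConn a t}) *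
        (prodBernoulli w).real ({ω | ∀ t ∈ T, ω ∉ openConn a t} ∩
            {ω | ∀ t ∈ T, ∀ t' ∈ T, t ≠ t' → ω ∉ openConn t t'}) ≤
      (prodBernoulli w).real {ω | ∀ t ∈ T, ω ∉ openConn a t} *
        (prodBernoulli w).real (openConn o a ∩ ({ω | ∀ t ∈ T, ω ∉ openConn a t} ∩
              {ω | ∀ t ∈ T, ∀ t' ∈ T, t ≠ t' → ω ∉ openConn t t'})))
    (hcont : ∀ (n : ℕ) (E : Set (BondConfig (Fin n))),
      Continuous fun w : Sym2 (Fin n) → unitInterval => (prodBernoulli w).real E)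
    (w : Sym2 (Fin n) → unitInterval) (A X : Finset (Fin n)) (o q : Fin n) (hq : q ∈ A) (hX : X ⊆ A.erase q)
    (hcmp : ∀ b ∈ X, (prodBernoulli w).real {ω | ∀ t ∈ A.erase b, ω ∉ openConn b t} ≤
      (prodBernoulli w).real {ω | ∀ t ∈ A.erase q, ω ∉ openConn q t}) :
    ∑ b ∈ X, (prodBernoulli w).real (openConn o b ∩ {ω | ∀ t ∈ A.erase b, ω ∉ openConn b t}) ≤
      (prodBernoulli w).real ({ω | ∀ t ∈ A.erase q, ω ∉ openConn q t} ∩ ⋃ b ∈ X, openConn o b) := by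
  -- scaled weights `w_k = (1 - 1/(k+1)) • w`, all `< 1`, converging to `w`
  have hcmem : ∀ k : ℕ, ((1 : ℝ) - 1 / ((k : ℝ) + 1)) ∈ unitInterval := by
    intro k
    have hk : (0 : ℝ) < (k : ℝ) + 1 := Nat.cast_add_one_pos k
    have h1 : 1 / ((k : ℝ) + 1) ≤ 1 := by
      rw [div_le_one hk]; linarith [(Nat.cast_nonneg k : (0 : ℝ) ≤ k)]
    have h0 : 0 ≤ 1 / ((k : ℝ) + 1) := by positivity
    exact ⟨by linarith, by linarith⟩
  set wk : ℕ → Sym2 (Fin n) → unitInterval :=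
    fun k e => ⟨(1 - 1 / ((k : ℝ) + 1)) * (w e : ℝ), unitInterval.mul_mem (hcmem k) (w e).2⟩
    with hwk_def
  have hwk_lt : ∀ k e, ((wk k e : unitInterval) : ℝ) < 1 := by
    intro k e
    have hk : (0 : ℝ) < (k : ℝ) + 1 := Nat.cast_add_one_pos k
    have hc : (1 : ℝ) - 1 / ((k : ℝ) + 1) < 1 := by
      have : 0 < 1 / ((k : ℝ) + 1) := by positivity
      linarith
    calc ((wk k e : unitInterval) : ℝ) = (1 - 1 / ((k : ℝ) + 1)) * (w e : ℝ) := rfl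
      _ ≤ (1 - 1 / ((k : ℝ) + 1)) := mul_le_of_le_one_right (hcmem k).1 (w e).2.2
      _ < 1 := hc
  have hc_lim : Tendsto (fun k : ℕ => (1 : ℝ) - 1 / ((k : ℝ) + 1)) atTop (𝓝 1) := by
    simpa using tendsto_const_nhds.sub (tendsto_one_div_add_atTop_nhds_zero_nat (𝕜 := ℝ))
  have hwk_lim : Tendsto wk atTop (𝓝 w) := by
    refine tendsto_pi_nhds.2 fun e => ?_
    rw [tendsto_subtype_rng]
    have h := hc_lim.mul_const (w e : ℝ)
    rw [one_mul] at h
    exact h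
  have hlimE : ∀ E : Set (Set (Sym2 (Fin n))),
      Tendsto (fun k => (prodBernoulli (wk k)).real E) atTop (𝓝 ((prodBernoulli w).real E)) :=
    fun E => ((hcont n E).tendsto w).comp hwk_lim
  -- error terms `δ k = ∑_{a ∈ A} |μ_{w_k}(D_a) - μ_w(D_a)| → 0`
  set δ : ℕ → ℝ := fun k => ∑ a ∈ A,
      |(prodBernoulli (wk k)).real {ω | ∀ t ∈ A.erase a, ω ∉ openConn a t} -
        (prodBernoulli w).real {ω | ∀ t ∈ A.erase a, ω ∉ openConn a t}|
    with hδ_def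
  have hδ0 : ∀ k, 0 ≤ δ k := fun k => Finset.sum_nonneg fun a _ => abs_nonneg _
  have hδ_lim : Tendsto δ atTop (𝓝 0) := by
    have h : ∀ a ∈ A, Tendsto (fun k =>
        |(prodBernoulli (wk k)).real {ω | ∀ t ∈ A.erase a, ω ∉ openConn a t} -
          (prodBernoulli w).real {ω | ∀ t ∈ A.erase a, ω ∉ openConn a t}|)
        atTop (𝓝 0) := by
      intro a _
      simpa using (tendsto_sub_nhds_zero_iff.2
        (hlimE {ω | ∀ t ∈ A.erase a, ω ∉ openConn a t})).abs
    simpa [hδ_def] using tendsto_finsetSum A h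
  have hδa : ∀ k, ∀ a ∈ A,
      |(prodBernoulli (wk k)).real {ω | ∀ t ∈ A.erase a, ω ∉ openConn a t} -
        (prodBernoulli w).real {ω | ∀ t ∈ A.erase a, ω ∉ openConn a t}| ≤ δ k := by
    intro k a ha
    exact Finset.single_le_sum (f := fun a =>
        |(prodBernoulli (wk k)).real {ω | ∀ t ∈ A.erase a, ω ∉ openConn a t} -
          (prodBernoulli w).real {ω | ∀ t ∈ A.erase a, ω ∉ openConn a t}|)
      (fun a _ => abs_nonneg _) ha
  have hXA : X ⊆ A := hX.trans (Finset.erase_subset q A)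
  -- the bound at each `k`, with deficiency `2 δ k`
  have hk : ∀ k, ∑ b ∈ X, (prodBernoulli (wk k)).real
      (openConn o b ∩ {ω | ∀ t ∈ A.erase b, ω ∉ openConn b t}) ≤
      (prodBernoulli (wk k)).real ({ω | ∀ t ∈ A.erase q, ω ∉ openConn q t} ∩ ⋃ b ∈ X, openConn o b) +
        2 * δ k := by
    intro k
    refine ux_level_one_of_pairSep_pos hTS (wk k) A X o q (2 * δ k) (by linarith [hδ0 k]) hq hX ?_
      (singleFinger_pairSep_real_pos (wk k) (hwk_lt k) _)
    intro b hb
    have h1 := hcmp b hb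
    have h2 := (abs_sub_le_iff.1 (hδa k b (hXA hb))).1
    have h3 := (abs_sub_le_iff.1 (hδa k q hq)).2
    linarith
  -- pass to the limit
  have hlim1 : Tendsto (fun k => ∑ b ∈ X, (prodBernoulli (wk k)).real
      (openConn o b ∩ {ω | ∀ t ∈ A.erase b, ω ∉ openConn b t})) atTop
      (𝓝 (∑ b ∈ X, (prodBernoulli w).real (openConn o b ∩ {ω | ∀ t ∈ A.erase b, ω ∉ openConn b t}))) :=
    tendsto_finsetSum X fun b _ => hlimE _
  have hlim2 : Tendsto (fun k => (prodBernoulli (wk k)).real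
      ({ω | ∀ t ∈ A.erase q, ω ∉ openConn q t} ∩ ⋃ b ∈ X, openConn o b) + 2 * δ k) atTop
      (𝓝 ((prodBernoulli w).real ({ω | ∀ t ∈ A.erase q, ω ∉ openConn q t} ∩ ⋃ b ∈ X, openConn o b))) := by
    simpa using (hlimE _).add (hδ_lim.const_mul 2)
  exact le_of_tendsto_of_tendsto' hlim1 hlim2 hk

/-- `{o ↔ X} ∩ {|π(o)| ≤ 1}` is the disjoint union over `b ∈ X ⊆ A` of `{o ↔ b} ∩ D_b`: its measure is the sum.
[folklore] -/
theorem real_touch_inter_card_le_one_eq_sum (w : Sym2 (Fin n) → unitInterval) (A X : Finset (Fin n))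
    (o : Fin n) (hXA : X ⊆ A) :
    (prodBernoulli w).real ((⋃ b ∈ X, openConn o b) ∩
        {ω : BondConfig (Fin n) | (A.filter fun x => ω ∈ openConn o x).card ≤ 1}) =
      ∑ b ∈ X, (prodBernoulli w).real (openConn o b ∩ {ω | ∀ t ∈ A.erase b, ω ∉ openConn b t}) := by
  have hmeas : ∀ s : Set (BondConfig (Fin n)), MeasurableSet s := fun _ => MeasurableSet.of_discrete
  have hset : ((⋃ b ∈ X, openConn o b) ∩
      {ω : BondConfig (Fin n) | (A.filter fun x => ω ∈ openConn o x).card ≤ 1}) =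
      ⋃ b ∈ X, (openConn o b ∩ {ω | ∀ t ∈ A.erase b, ω ∉ openConn b t}) := by
    ext ω
    simp only [Set.mem_inter_iff, Set.mem_iUnion, Set.mem_setOf_eq, exists_prop]
    constructor
    · rintro ⟨⟨b, hb, hob⟩, hcard⟩
      refine ⟨b, hb, hob, fun t ht hbt => ?_⟩
      obtain ⟨htb, htA⟩ := Finset.mem_erase.1 ht
      have hob' : (openGraph ω).Reachable o b := hob
      have hbt' : (openGraph ω).Reachable b t := hbt
      have hbmem : b ∈ A.filter fun x => ω ∈ openConn o x := Finset.mem_filter.2 ⟨hXA hb, hob⟩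
      have htmem : t ∈ A.filter fun x => ω ∈ openConn o x :=
        Finset.mem_filter.2 ⟨htA, (hob'.trans hbt' : (openGraph ω).Reachable o t)⟩
      have h2 : 2 ≤ (A.filter fun x => ω ∈ openConn o x).card := by
        have hsub : ({b, t} : Finset (Fin n)) ⊆ A.filter fun x => ω ∈ openConn o x := by
          intro x hx
          rcases Finset.mem_insert.1 hx with rfl | hx
          · exact hbmem
          · rw [Finset.mem_singleton.1 hx]; exact htmem
        have hcard2 : ({b, t} : Finset (Fin n)).card = 2 := Finset.card_pair (Ne.symm htb)
        exact hcard2 ▸ Finset.card_le_card hsub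
      omega
    · rintro ⟨b, hb, hob, hD⟩
      refine ⟨⟨b, hb, hob⟩, ?_⟩
      have hsub : (A.filter fun x => ω ∈ openConn o x) ⊆ {b} := by
        intro x hx
        obtain ⟨hxA, hox⟩ := Finset.mem_filter.1 hx
        rw [Finset.mem_singleton]
        by_contra hxb
        have hob' : (openGraph ω).Reachable o b := hob
        have hox' : (openGraph ω).Reachable o x := hox
        exact hD x (Finset.mem_erase.2 ⟨hxb, hxA⟩) (hob'.symm.trans hox')
      exact (Finset.card_le_card hsub).trans (by simp)
  rw [hset]
  exact measureReal_biUnion_finset (by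
    intro a ha a' ha' hne
    simp only [Function.onFun]
    refine Set.disjoint_left.2 fun ω hω hω' => ?_
    have hoa : (openGraph ω).Reachable o a := hω.1
    have hoa' : (openGraph ω).Reachable o a' := hω'.1
    exact hω.2 a' (Finset.mem_erase.2 ⟨Ne.symm hne, hXA (Finset.mem_coe.1 ha')⟩) (hoa.symm.trans hoa'))
    (fun b _ => hmeas _)

end UXLevelOne

open UXLevelOne AttachedChampionLevelOne in
/-- **Kozma–Nitzan's Lemma 3(i) for a SET of relays, at level one** (the `j = 1` slice of the family UX,
unconditional).  For every weighted graph on `Fin n`, relay set `A`, observer `o`, relay `q ∈ A` and set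
`X ⊆ A ∖ q` of relays each beaten by `q` at level one (`μ(|π(b)| ≤ 1) ≤ μ(|π(q)| ≤ 1)` for `b ∈ X`):
`μ(o ↔ X, |π(o)| ≤ 1) ≤ μ(o ↔ X, |π(q)| ≤ 1)`.  For `X = {r}` this is Kozma–Nitzan's Lemma 3(i); for `X = A ∖ q`
and a level-one champion `q` it is the lead's `attachedChampion_level_one` (the registered stub at `j = 1`).
Inputs: BHK 2006 Thm 1.3 for a single vertex (`stub_terminalSeparation`,
`BHK2006_clusterConditionalPositiveAssociation_holds`) and for a vertex set
(`BHK2006_setClusterConditionalPositiveAssociation`), weight continuity (`stub_weightContinuity`).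
[cite: KozmaNitzan2024, Lemma 2 (p. 6), Lemma 3(i) (pp. 6–7); VandenbergHaggstromKahn2005, Thm. 1.3 (p. 5)] -/
theorem ux_level_one (n : ℕ) (w : Sym2 (Fin n) → unitInterval) (A X : Finset (Fin n)) (o q : Fin n)
    (hq : q ∈ A) (hX : X ⊆ A.erase q)
    (hbeat : ∀ b ∈ X,
      (prodBernoulli w).real {ω : BondConfig (Fin n) | (A.filter fun x => ω ∈ openConn b x).card ≤ 1} ≤
        (prodBernoulli w).real {ω : BondConfig (Fin n) | (A.filter fun x => ω ∈ openConn q x).card ≤ 1}) :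
    (prodBernoulli w).real ((⋃ b ∈ X, openConn o b) ∩
        {ω : BondConfig (Fin n) | (A.filter fun x => ω ∈ openConn o x).card ≤ 1}) ≤
      (prodBernoulli w).real ((⋃ b ∈ X, openConn o b) ∩
        {ω : BondConfig (Fin n) | (A.filter fun x => ω ∈ openConn q x).card ≤ 1}) := by
  have hXA : X ⊆ A := hX.trans (Finset.erase_subset q A)
  have hTS : ∀ (n : ℕ) (w : Sym2 (Fin n) → unitInterval) (T : Finset (Fin n)) (o a : Fin n),
      (prodBernoulli w).real (openConn o a ∩ {ω | ∀ t ∈ T, ω ∉ openConn a t}) *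
        (prodBernoulli w).real ({ω | ∀ t ∈ T, ω ∉ openConn a t} ∩
            {ω | ∀ t ∈ T, ∀ t' ∈ T, t ≠ t' → ω ∉ openConn t t'}) ≤
      (prodBernoulli w).real {ω | ∀ t ∈ T, ω ∉ openConn a t} *
        (prodBernoulli w).real (openConn o a ∩ ({ω | ∀ t ∈ T, ω ∉ openConn a t} ∩
              {ω | ∀ t ∈ T, ∀ t' ∈ T, t ≠ t' → ω ∉ openConn t t'})) := by
    refine stub_terminalSeparation ?_
    intro n w s X F G hF hG hs
    exact BHK2006_clusterConditionalPositiveAssociation_holds (Fin n) w s X F G hF hG hs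
  have hcmp : ∀ b ∈ X, (prodBernoulli w).real {ω | ∀ t ∈ A.erase b, ω ∉ openConn b t} ≤
      (prodBernoulli w).real {ω | ∀ t ∈ A.erase q, ω ∉ openConn q t} := by
    intro b hb
    rw [← setOf_card_le_one_eq A (hXA hb), ← setOf_card_le_one_eq A hq]
    exact hbeat b hb
  have key := ux_level_one_sum_of_terminalSeparation hTS stub_weightContinuity w A X o q hq hX hcmp
  rw [real_touch_inter_card_le_one_eq_sum w A X o hXA, setOf_card_le_one_eq A hq, Set.inter_comm]
  exact key

end Summit.CriticalPhenomena.PercolationContinuityZ3.Theorems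

end
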